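/-
Copyright (c) 2026. All rights reserved.
Released under Apache 2.0 license as described in the file LICENSE.
-/
import Mathlib
import Summits.RiemannHypothesis.RiemannHypothesis.Theorems.HandoffLatticeUncertaintyAux
import Summits.RiemannHypothesis.RiemannHypothesis.Theorems.HandoffLatticeTailRigidity
import Literature.Analysis.FunctionSpaces.PlancherelL1L2
import HarnessLib

/-!
# THEOREM P: the lattice tail of a nonzero vector vanishes on no interval `(0, δ)`

`HANDOFF/prove-1` gen15, ATTEMPT-22 §2–§3. For `F : ℝ → ℂ` bounded, measurable, vanishing off
`(0, λ]`, not a.e. zero there, whose dilation sum `θ_F = dilationSum λ F` satisfies MÜNTZ'S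
FORMULA `𝓜θ_F = ζ·𝓜F` on the open critical strip (a hypothesis here, discharged for Lipschitz
data with `∫ F = 0` by the tree's `mellin_tsum_indicator_comp_mul_nat`): for every `δ > 0`,
`θ_F` is NOT a.e. zero on `(0, δ)` (`dilationSum_not_ae_zero`) — the tail has unbounded depth.
Proof: if it were, `θ_F` agrees a.e. on `(0, ∞)` with `θ̃ = 1_{[δ, λ]}·θ_F`, whose Mellin transform
is ENTIRE of exponential type (`norm_mellin_le_of_support`) and, by Müntz, divisible by `ζ` near
every nontrivial zero; the core `entire_eq_zero_of_riemannZeta_dvd` (Jensen vs. Riemann–von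
Mangoldt) kills it, Mellin–Plancherel (tree) gives `θ̃ = 0` a.e., and the triangular system
`θ_F(y) = F(y) + Σ_{m ≥ 2} F(my)` forces `F = 0` a.e. RH-free; nothing here bears on RH.
-/

noncomputable section

set_option linter.dupNamespace false

open Complex MeasureTheory Set Filter Asymptotics
open Literature.NumberTheory.LFunctions

namespace Summit.RiemannHypothesis.RiemannHypothesis.Theorems

namespace LatticeUncertainty

/-! ## Mellin transforms of bounded functions supported in `[a, b] ⊂ (0, ∞)` -/

section MellinCompact

variable {θ : ℝ → ℂ} {a b Mθ : ℝ}

/-- Such a function is `O(x^{-c})` at `∞` for every `c` (it vanishes eventually). -/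
theorem isBigO_atTop_of_support (hθs : ∀ u, u ∉ Icc a b → θ u = 0) (c : ℝ) :
    θ =O[atTop] fun x : ℝ ↦ x ^ (-c) := by
  have h0 : θ =ᶠ[atTop] fun _ ↦ (0 : ℂ) := by
    filter_upwards [eventually_gt_atTop b] with u hu
    exact hθs u fun h ↦ not_le.mpr hu h.2
  exact (isBigO_zero _ _).congr' h0.symm EventuallyEq.rfl

/-- Such a function is `O(x^{-c})` at `0⁺` for every `c` (it vanishes near `0`), if `0 < a`. -/
theorem isBigO_nhdsGT_of_support (ha : 0 < a) (hθs : ∀ u, u ∉ Icc a b → θ u = 0) (c : ℝ) :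
    θ =O[nhdsWithin 0 (Ioi 0)] fun x : ℝ ↦ x ^ (-c) := by
  have h0 : θ =ᶠ[nhdsWithin 0 (Ioi 0)] fun _ ↦ (0 : ℂ) := by
    have : Iio a ∈ nhdsWithin (0 : ℝ) (Ioi 0) := mem_nhdsWithin_of_mem_nhds (Iio_mem_nhds ha)
    filter_upwards [this] with u hu
    exact hθs u fun h ↦ not_lt.mpr h.1 hu
  exact (isBigO_zero _ _).congr' h0.symm EventuallyEq.rfl

/-- The Mellin transform of a bounded measurable function supported in `[a, b]`, `a > 0`,
converges absolutely everywhere. -/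
theorem mellinConvergent_of_support (ha : 0 < a) (hθm : Measurable θ) (hθb : ∀ u, ‖θ u‖ ≤ Mθ)
    (hθs : ∀ u, u ∉ Icc a b → θ u = 0) (s : ℂ) : MellinConvergent θ s :=
  mellinConvergent_of_isBigO_rpow (a := s.re + 1) (b := s.re - 1)
    ((integrable_of_bdd_of_support hθm.aestronglyMeasurable hθb hθs).locallyIntegrable
      |>.locallyIntegrableOn _)
    (isBigO_atTop_of_support hθs _) (by linarith) (isBigO_nhdsGT_of_support ha hθs _) (by linarith)

/-- The Mellin transform of a bounded measurable function supported in `[a, b]`, `a > 0`, is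
entire. -/
theorem differentiable_mellin_of_support (ha : 0 < a) (hθm : Measurable θ)
    (hθb : ∀ u, ‖θ u‖ ≤ Mθ) (hθs : ∀ u, u ∉ Icc a b → θ u = 0) :
    Differentiable ℂ (mellin θ) := fun s ↦
  mellin_differentiableAt_of_isBigO_rpow (a := s.re + 1) (b := s.re - 1)
    ((integrable_of_bdd_of_support hθm.aestronglyMeasurable hθb hθs).locallyIntegrable
      |>.locallyIntegrableOn _)
    (isBigO_atTop_of_support hθs _) (by linarith) (isBigO_nhdsGT_of_support ha hθs _) (by linarith)

/-- On `[a, b]` with `0 < a ≤ b`, `t^e ≤ K^{|e|}` for `K = max a⁻¹ b` (note `K ≥ 1`). -/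
theorem rpow_le_max_rpow_abs (ha : 0 < a) (hab : a ≤ b) {t : ℝ} (ht : t ∈ Icc a b) (e : ℝ) :
    t ^ e ≤ (max a⁻¹ b) ^ |e| := by
  set K := max a⁻¹ b with hK_def
  have ht0 : 0 < t := ha.trans_le ht.1
  have hK1 : 1 ≤ K := by
    rcases le_or_gt 1 b with hb | hb
    · exact hb.trans (le_max_right _ _)
    · have : 1 ≤ a⁻¹ := (one_le_inv₀ ha).mpr (hab.trans hb.le)
      exact this.trans (le_max_left _ _)
  rcases le_or_gt 0 e with he | he
  · rw [abs_of_nonneg he]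
    calc t ^ e ≤ b ^ e := Real.rpow_le_rpow ht0.le ht.2 he
      _ ≤ K ^ e := Real.rpow_le_rpow (ht0.le.trans ht.2) (le_max_right _ _) he
  · rw [abs_of_neg he]
    have h1 : t ^ e = (t⁻¹) ^ (-e) := by
      rw [Real.inv_rpow ht0.le, ← Real.rpow_neg ht0.le, neg_neg]
    rw [h1]
    have hti : t⁻¹ ≤ a⁻¹ := (inv_le_inv₀ ht0 ha).mpr ht.1
    calc (t⁻¹) ^ (-e) ≤ (a⁻¹) ^ (-e) := Real.rpow_le_rpow (inv_nonneg.mpr ht0.le) hti (by linarith)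
      _ ≤ K ^ (-e) := Real.rpow_le_rpow (inv_nonneg.mpr ha.le) (le_max_left _ _) (by linarith)

/-- **Exponential type.** For `θ` bounded by `Mθ`, measurable, supported in `[a, b]` with
`0 < a ≤ b`, and `K = max a⁻¹ b`: `‖𝓜θ(s)‖ ≤ (Mθ (b − a) K) · K^{‖s‖}` for all `s ∈ ℂ`. -/
theorem norm_mellin_le_of_support (ha : 0 < a) (hab : a ≤ b) (hθb : ∀ u, ‖θ u‖ ≤ Mθ)
    (hθs : ∀ u, u ∉ Icc a b → θ u = 0) (s : ℂ) :
    ‖mellin θ s‖ ≤ Mθ * (b - a) * max a⁻¹ b * (max a⁻¹ b) ^ ‖s‖ := by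
  set K := max a⁻¹ b with hK_def
  have hK1 : 1 ≤ K := by
    rcases le_or_gt 1 b with hb | hb
    · exact hb.trans (le_max_right _ _)
    · have : 1 ≤ a⁻¹ := (one_le_inv₀ ha).mpr (hab.trans hb.le)
      exact this.trans (le_max_left _ _)
  have hK0 : 0 < K := by linarith
  have hM0 : 0 ≤ Mθ := (norm_nonneg _).trans (hθb a)
  -- restrict the Mellin integral to `[a, b]`
  have hsub : Icc a b ⊆ Ioi (0 : ℝ) := fun t ht ↦ ha.trans_le ht.1
  have hrestr : mellin θ s = ∫ t in Icc a b, (t : ℂ) ^ (s - 1) • θ t := by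
    rw [mellin]
    refine setIntegral_eq_of_subset_of_forall_sdiff_eq_zero measurableSet_Ioi hsub ?_
    intro t ht
    rw [hθs t ht.2, smul_zero]
  rw [hrestr]
  -- pointwise bound of the integrand on `[a, b]`
  have hpt : ∀ t ∈ Icc a b, ‖(t : ℂ) ^ (s - 1) • θ t‖ ≤ Mθ * K * K ^ ‖s‖ := by
    intro t ht
    have ht0 : 0 < t := ha.trans_le ht.1
    rw [norm_smul, Complex.norm_cpow_eq_rpow_re_of_pos ht0, sub_re, one_re]
    have h1 : t ^ (s.re - 1) ≤ K ^ |s.re - 1| := rpow_le_max_rpow_abs ha hab ht _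
    have h2 : |s.re - 1| ≤ ‖s‖ + 1 := by
      calc |s.re - 1| ≤ |s.re| + |(1 : ℝ)| := abs_sub _ _
        _ ≤ ‖s‖ + 1 := by rw [abs_one]; linarith [Complex.abs_re_le_norm s]
    have h3 : K ^ |s.re - 1| ≤ K ^ (‖s‖ + 1) := Real.rpow_le_rpow_of_exponent_le hK1 h2
    have h4 : K ^ (‖s‖ + 1) = K * K ^ ‖s‖ := by
      rw [Real.rpow_add hK0, Real.rpow_one, mul_comm]
    calc t ^ (s.re - 1) * ‖θ t‖ ≤ K ^ (‖s‖ + 1) * Mθ :=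
          mul_le_mul (h1.trans h3) (hθb t) (norm_nonneg _) (by positivity)
      _ = Mθ * K * K ^ ‖s‖ := by rw [h4]; ring
  have hvol : volume (Icc a b) < ⊤ := by simp
  calc ‖∫ t in Icc a b, (t : ℂ) ^ (s - 1) • θ t‖
      ≤ (Mθ * K * K ^ ‖s‖) * volume.real (Icc a b) :=
        norm_setIntegral_le_of_norm_le_const hvol hpt
    _ = Mθ * (b - a) * K * K ^ ‖s‖ := by rw [Real.volume_real_Icc_of_le hab]; ring

/-- **Injectivity.** If the Mellin transform of such a `θ` vanishes on the critical line, then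
`θ = 0` a.e. on `(0, ∞)` (Mellin–Plancherel, tree theorem `integral_norm_sq_mellin_half_eq`). -/
theorem ae_eq_zero_of_mellin_eq_zero (ha : 0 < a) (hθm : Measurable θ) (hθb : ∀ u, ‖θ u‖ ≤ Mθ)
    (hθs : ∀ u, u ∉ Icc a b → θ u = 0) (h0 : ∀ τ : ℝ, mellin θ (1 / 2 + τ * I) = 0) :
    ∀ᵐ u ∂(volume.restrict (Ioi 0)), θ u = 0 := by
  have hM0 : 0 ≤ Mθ := (norm_nonneg _).trans (hθb a)
  have hsq : Integrable (fun x : ℝ ↦ ‖θ x‖ ^ 2) := by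
    refine integrable_of_bdd_of_support (M := Mθ ^ 2) (a := a) (b := b)
      (hθm.norm.pow_const 2).aestronglyMeasurable (fun x ↦ ?_) (fun x hx ↦ ?_)
    · rw [Real.norm_of_nonneg (by positivity)]
      exact pow_le_pow_left₀ (norm_nonneg _) (hθb x) 2
    · rw [hθs x hx, norm_zero, zero_pow two_ne_zero]
  obtain ⟨-, hP⟩ := Literature.Analysis.FunctionSpaces.integral_norm_sq_mellin_half_eq
    (mellinConvergent_of_support ha hθm hθb hθs _) hsq.integrableOn
  simp only [h0, norm_zero, zero_pow two_ne_zero, integral_zero] at hP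
  have hI : ∫ x in Ioi 0, ‖θ x‖ ^ 2 = 0 := by
    have : (2 : ℝ) * Real.pi ≠ 0 := by positivity
    exact (mul_eq_zero.mp hP.symm).resolve_left this
  have hae := (setIntegral_eq_zero_iff_of_nonneg_ae (Eventually.of_forall fun x ↦ by positivity)
    hsq.integrableOn).mp hI
  filter_upwards [hae] with u hu
  simpa using hu

end MellinCompact

/-! ## From the dilation sums back to `F`: the triangular system `θ_F(y) = F(y) + Σ_{m≥2} F(my)` -/

section Moebius

variable {lam : ℝ} {F : ℝ → ℂ}

/-- If every dilation sum `θ_F(jy)`, `j ≥ 1`, along the multiples of `y > 0` vanishes, then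
`F y = 0` (downward induction on `⌊λ/y⌋`; `F` vanishes beyond `λ`). -/
theorem eq_zero_of_dilationSum_multiples_eq_zero (hFs : ∀ x, lam < x → F x = 0) :
    ∀ (n : ℕ) (y : ℝ), 0 < y → ⌊lam / y⌋₊ ≤ n →
      (∀ j : ℕ, 1 ≤ j → dilationSum lam F (j * y) = 0) → F y = 0 := by
  intro n
  induction n with
  | zero =>
    intro y hy hfl _
    exact hFs y ((div_lt_one hy).mp (Nat.floor_eq_zero.mp (Nat.le_zero.mp hfl)))
  | succ n ih =>
    intro y hy hfl hall
    by_cases hlam : lam < y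
    · exact hFs y hlam
    replace hlam := not_lt.mp hlam
    have hN1 : 1 ≤ ⌊lam / y⌋₊ := Nat.one_le_floor_iff _ |>.mpr (by rwa [le_div_iff₀ hy, one_mul])
    -- the `j = 1` sum: `θ_F(y) = F y + Σ_{m ≥ 2} F(my) = 0`
    have h1 := hall 1 le_rfl
    rw [Nat.cast_one, one_mul, dilationSum] at h1
    have hmem : 1 ∈ Finset.Icc 1 ⌊lam / y⌋₊ := Finset.mem_Icc.mpr ⟨le_rfl, hN1⟩
    rw [← Finset.add_sum_erase _ _ hmem, Nat.cast_one, one_mul] at h1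
    -- every `F(my)`, `m ≥ 2`, vanishes by the induction hypothesis
    have hrest : ∑ m ∈ (Finset.Icc 1 ⌊lam / y⌋₊).erase 1, F (m * y) = 0 := by
      refine Finset.sum_eq_zero fun m hm ↦ ?_
      rw [Finset.mem_erase, Finset.mem_Icc] at hm
      obtain ⟨hm1', hm1, hmN⟩ := hm
      have hm2 : 2 ≤ m := by omega
      have hmy : 0 < (m : ℝ) * y := by positivity
      refine ih (m * y) hmy ?_ ?_
      · -- `⌊λ/(my)⌋ ≤ n`
        have hlam0 : 0 ≤ lam := hy.le.trans hlam
        have hq : lam / (m * y) ≤ lam / y / 2 := by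
          rw [div_div]
          have h2m : (2 : ℝ) ≤ m := by exact_mod_cast hm2
          exact div_le_div_of_nonneg_left hlam0 (by positivity) (by nlinarith)
        have hlt : lam / y < (n : ℝ) + 2 := by
          have := Nat.lt_floor_add_one (lam / y)
          have hfl' : (⌊lam / y⌋₊ : ℝ) ≤ n + 1 := by exact_mod_cast hfl
          linarith
        have hlt' : lam / (m * y) < n + 1 := by
          have : ((n : ℝ) + 2) / 2 ≤ n + 1 := by
            have : (0 : ℝ) ≤ n := Nat.cast_nonneg n
            linarith
          linarith [div_le_div_of_nonneg_right hlt.le (by norm_num : (0:ℝ) ≤ 2)]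
        have := (Nat.floor_lt (div_nonneg hlam0 hmy.le)).mpr (by exact_mod_cast hlt')
        omega
      · intro j hj
        have : (j : ℝ) * ((m : ℝ) * y) = ((j * m : ℕ) : ℝ) * y := by push_cast; ring
        rw [this]
        exact hall (j * m) (Nat.one_le_iff_ne_zero.mpr (Nat.mul_ne_zero
          (Nat.one_le_iff_ne_zero.mp hj) (by omega)))
    rw [hrest, add_zero] at h1
    exact h1

/-- **a.e. version.** If `F` vanishes on `(λ, ∞)` and `θ_F = 0` a.e. on `(0, ∞)`, then `F = 0`
a.e. on `(0, ∞)` (the exceptional sets along the multiples `jx` are null by scaling). -/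
theorem ae_eq_zero_of_dilationSum_ae_eq_zero (hFs : ∀ x, lam < x → F x = 0)
    (hG : ∀ᵐ u ∂(volume.restrict (Ioi 0)), dilationSum lam F u = 0) :
    ∀ᵐ x ∂(volume.restrict (Ioi 0)), F x = 0 := by
  set N : Set ℝ := {u | u ∈ Ioi (0 : ℝ) ∧ dilationSum lam F u ≠ 0} with hN_def
  have hN : volume N = 0 := by
    rw [ae_restrict_iff' measurableSet_Ioi, ae_iff] at hG
    refine measure_mono_null (fun u hu ↦ ?_) hG
    exact fun h ↦ hu.2 (h hu.1)
  set E : Set ℝ := ⋃ j : ℕ, (fun x : ℝ ↦ ((j + 1 : ℕ) : ℝ) * x) ⁻¹' N with hE_def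
  have hE : volume E = 0 := by
    refine measure_iUnion_null fun j ↦ ?_
    rw [Real.volume_preimage_mul_left (by exact_mod_cast Nat.succ_ne_zero j), hN, mul_zero]
  have hEae : ∀ᵐ x ∂(volume.restrict (Ioi (0 : ℝ))), x ∉ E :=
    ae_restrict_of_ae (measure_eq_zero_iff_ae_notMem.mp hE)
  rw [ae_restrict_iff' measurableSet_Ioi] at hEae ⊢
  filter_upwards [hEae] with x hxE hx
  refine eq_zero_of_dilationSum_multiples_eq_zero hFs ⌊lam / x⌋₊ x hx le_rfl fun j hj ↦ ?_
  by_contra hne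
  apply hxE hx
  refine mem_iUnion.mpr ⟨j - 1, ?_⟩
  have hj' : ((j - 1 + 1 : ℕ) : ℝ) = j := by rw [Nat.sub_add_cancel hj]
  refine ⟨?_, ?_⟩
  · show 0 < ((j - 1 + 1 : ℕ) : ℝ) * x
    rw [hj']; exact mul_pos (Nat.cast_pos.mpr hj) hx
  · show dilationSum lam F (((j - 1 + 1 : ℕ) : ℝ) * x) ≠ 0
    rw [hj']; exact hne

end Moebius

/-! ## THEOREM P -/

section TheoremP

variable {lam : ℝ} {F : ℝ → ℂ}

/-- For `0 ≤ λ < u` the dilation sum is empty. -/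
theorem dilationSum_eq_zero_of_lt (hlam : 0 ≤ lam) {u : ℝ} (hu : lam < u) :
    dilationSum lam F u = 0 := by
  have hu0 : 0 < u := hlam.trans_lt hu
  have : ⌊lam / u⌋₊ = 0 := Nat.floor_eq_zero.mpr ((div_lt_one hu0).mpr hu)
  rw [dilationSum, this]
  simp

/-- Crude bound: `‖θ_F(u)‖ ≤ ⌊λ/u⌋ · M` if `‖F‖ ≤ M`. -/
theorem norm_dilationSum_le_floor_mul {MF : ℝ} (hFb : ∀ x, ‖F x‖ ≤ MF) (u : ℝ) :
    ‖dilationSum lam F u‖ ≤ ⌊lam / u⌋₊ * MF := by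
  rw [dilationSum]
  calc ‖∑ n ∈ Finset.Icc 1 ⌊lam / u⌋₊, F (n * u)‖
      ≤ ∑ n ∈ Finset.Icc 1 ⌊lam / u⌋₊, ‖F (n * u)‖ := norm_sum_le _ _
    _ ≤ ∑ n ∈ Finset.Icc 1 ⌊lam / u⌋₊, MF := Finset.sum_le_sum fun n _ ↦ hFb _
    _ = ⌊lam / u⌋₊ * MF := by simp

/-- The Mellin transform of a bounded measurable `F` vanishing off `(0, λ]` is holomorphic on
`Re s > 0`. -/
theorem differentiableAt_mellin_of_bdd (hFm : Measurable F) {MF : ℝ} (hFb : ∀ x, ‖F x‖ ≤ MF)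
    (hFs : ∀ x, x ∉ Ioc 0 lam → F x = 0) {s : ℂ} (hs : 0 < s.re) :
    DifferentiableAt ℂ (mellin F) s := by
  have hFs' : ∀ x, x ∉ Icc 0 lam → F x = 0 := fun x hx ↦ hFs x fun h ↦ hx (Ioc_subset_Icc_self h)
  have hloc : LocallyIntegrableOn F (Ioi 0) :=
    (integrable_of_bdd_of_support hFm.aestronglyMeasurable hFb hFs').locallyIntegrable
      |>.locallyIntegrableOn _
  have htop : F =O[atTop] fun x : ℝ ↦ x ^ (-(s.re + 1)) := by
    have h0 : F =ᶠ[atTop] fun _ ↦ (0 : ℂ) := by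
      filter_upwards [eventually_gt_atTop lam] with x hx
      exact hFs x fun h ↦ not_le.mpr hx h.2
    exact (isBigO_zero _ _).congr' h0.symm EventuallyEq.rfl
  have hbot : F =O[nhdsWithin 0 (Ioi 0)] fun x : ℝ ↦ x ^ (-(0 : ℝ)) := by
    refine IsBigO.of_bound MF (Eventually.of_forall fun x ↦ ?_)
    rw [neg_zero, Real.rpow_zero, norm_one, mul_one]
    exact hFb x
  exact mellin_differentiableAt_of_isBigO_rpow (a := s.re + 1) (b := 0) hloc htop (by linarith)
    hbot hs

/-- **THEOREM P (abstract form).** Let `F` be bounded and measurable, vanishing off `(0, λ]`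
(`λ > 0`), not a.e. zero on `(0, λ]`, and suppose Müntz's formula
`𝓜(θ_F)(s) = ζ(s)·𝓜F(s)` holds on the open critical strip. Then for every `δ > 0` the dilation
sum `θ_F` is NOT a.e. zero on `(0, δ)`: the lattice tail has unbounded depth. -/
theorem dilationSum_not_ae_zero (hlam : 0 < lam) (hFm : Measurable F) {MF : ℝ}
    (hFb : ∀ x, ‖F x‖ ≤ MF) (hFs : ∀ x, x ∉ Ioc 0 lam → F x = 0)
    (hMuntz : ∀ s : ℂ, 0 < s.re → s.re < 1 →
      mellin (dilationSum lam F) s = riemannZeta s * mellin F s)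
    (hne : ¬ ∀ᵐ x ∂(volume.restrict (Ioc 0 lam)), F x = 0) {δ : ℝ} (hδ : 0 < δ) :
    ¬ ∀ᵐ u ∂(volume.restrict (Ioo 0 δ)), dilationSum lam F u = 0 := by
  intro hT
  apply hne
  have hMF : 0 ≤ MF := (norm_nonneg _).trans (hFb 0)
  have hFs' : ∀ x, lam < x → F x = 0 := fun x hx ↦ hFs x fun h ↦ not_lt.mpr h.2 hx
  set G := dilationSum lam F with hG_def
  have hGm : Measurable G := measurable_dilationSum hFm lam
  -- Step 1: `G = 0` a.e. on `(0, ∞)`.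
  have hGae : ∀ᵐ u ∂(volume.restrict (Ioi 0)), G u = 0 := by
    -- the bounded compactly supported modification
    set θ : ℝ → ℂ := (Icc δ lam).indicator G with hθ_def
    have hθm : Measurable θ := hGm.indicator measurableSet_Icc
    have hθs : ∀ u, u ∉ Icc δ lam → θ u = 0 := fun u hu ↦ indicator_of_notMem hu _
    have hθb : ∀ u, ‖θ u‖ ≤ lam / δ * MF := by
      intro u
      by_cases hu : u ∈ Icc δ lam
      · rw [hθ_def, indicator_of_mem hu]
        have hu0 : 0 < u := hδ.trans_le hu.1
        calc ‖G u‖ ≤ ⌊lam / u⌋₊ * MF := norm_dilationSum_le_floor_mul hFb u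
          _ ≤ lam / u * MF := mul_le_mul_of_nonneg_right (Nat.floor_le (by positivity)) hMF
          _ ≤ lam / δ * MF := by
            gcongr
            exact hu.1
      · rw [hθs u hu, norm_zero]; positivity
    -- `θ = G` a.e. on `(0, ∞)`
    have hθG : ∀ᵐ u ∂(volume.restrict (Ioi 0)), θ u = G u := by
      have hT' : ∀ᵐ u ∂volume, u ∈ Ioo 0 δ → G u = 0 :=
        (ae_restrict_iff' measurableSet_Ioo).mp hT
      rw [ae_restrict_iff' measurableSet_Ioi]
      filter_upwards [hT'] with u hu hu0
      by_cases h1 : u < δ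
      · have hGu : G u = 0 := hu (mem_Ioo.mpr ⟨hu0, h1⟩)
        rw [hθs u fun h ↦ not_lt.mpr h.1 h1, hGu]
      by_cases h2 : u ≤ lam
      · rw [hθ_def, indicator_of_mem (mem_Icc.mpr ⟨not_lt.mp h1, h2⟩)]
      · rw [hθs u fun h ↦ h2 h.2, hG_def, dilationSum_eq_zero_of_lt hlam.le (not_le.mp h2)]
    have hmellin : ∀ s, mellin θ s = mellin G s := by
      intro s
      rw [mellin, mellin]
      refine integral_congr_ae ?_
      filter_upwards [hθG] with u hu
      rw [hu]
    by_cases hδl : δ ≤ lam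
    · -- the Mellin route
      have hΦ := differentiable_mellin_of_support hδ hθm hθb hθs
      have hzero : ∀ ρ : ℂ, riemannZeta ρ = 0 → 0 < ρ.re → ρ.re < 1 →
          ∃ M : ℂ → ℂ, AnalyticAt ℂ M ρ ∧ mellin θ =ᶠ[nhds ρ] fun s ↦ riemannZeta s * M s := by
        intro ρ _ h0 h1
        refine ⟨mellin F, ?_, ?_⟩
        · -- `𝓜F` is analytic on the right half-plane
          have hU : IsOpen {s : ℂ | 0 < s.re} := isOpen_lt continuous_const Complex.continuous_re
          have hdiff : DifferentiableOn ℂ (mellin F) {s : ℂ | 0 < s.re} := fun s hs ↦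
            (differentiableAt_mellin_of_bdd hFm hFb hFs hs).differentiableWithinAt
          exact hdiff.analyticAt (hU.mem_nhds h0)
        · have hU : IsOpen {s : ℂ | 0 < s.re ∧ s.re < 1} :=
            (isOpen_lt continuous_const Complex.continuous_re).inter
              (isOpen_lt Complex.continuous_re continuous_const)
          filter_upwards [hU.mem_nhds ⟨h0, h1⟩] with s hs
          rw [hmellin s]
          exact hMuntz s hs.1 hs.2
      have hK1 : 1 ≤ max δ⁻¹ lam := by
        rcases le_or_gt 1 lam with hb | hb
        · exact hb.trans (le_max_right _ _)
        · have : 1 ≤ δ⁻¹ := (one_le_inv₀ hδ).mpr (hδl.trans hb.le)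
          exact this.trans (le_max_left _ _)
      have hΦ0 := entire_eq_zero_of_riemannZeta_dvd hΦ hK1
        (norm_mellin_le_of_support hδ hδl hθb hθs) hzero
      have hθ0 := ae_eq_zero_of_mellin_eq_zero hδ hθm hθb hθs (fun τ ↦ by rw [hΦ0]; rfl)
      filter_upwards [hθ0, hθG] with u h1 h2
      rw [← h2, h1]
    · -- `δ > λ`: `G = 0` a.e. on `(0, δ) ⊇ (0, λ]` and `G = 0` on `(λ, ∞)` outright
      replace hδl := not_le.mp hδl
      have hT' : ∀ᵐ u ∂volume, u ∈ Ioo 0 δ → G u = 0 :=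
        (ae_restrict_iff' measurableSet_Ioo).mp hT
      rw [ae_restrict_iff' measurableSet_Ioi]
      filter_upwards [hT'] with u hu hu0
      by_cases h : u ≤ lam
      · exact hu (mem_Ioo.mpr ⟨hu0, h.trans_lt hδl⟩)
      · exact dilationSum_eq_zero_of_lt hlam.le (not_le.mp h)
  -- Step 2: `F = 0` a.e. on `(0, ∞)`, hence on `(0, λ]`.
  have hF0 := ae_eq_zero_of_dilationSum_ae_eq_zero hFs' hGae
  exact ae_restrict_of_ae_restrict_of_subset Ioc_subset_Ioi_self hF0

end TheoremP

end LatticeUncertainty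

end Summit.RiemannHypothesis.RiemannHypothesis.Theorems
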